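import Summits.QuantumFields.BalabanUV.Beta.MultiscaleDecay
import Summits.QuantumFields.BalabanUV.Beta.CovariantTowerDecayCT

/-!
# Beta / MultiscaleDecayDirichlet — NODE (w3) OF THE O.2 SKELETON §8.6, FIRST HALF: THE DIRICHLET INVERSES OF THE MULTI-REGION
# AVERAGED OPERATOR DECAY WITH THE SAME LOCAL PREFACTORS, ON EVERY DOMAIN (MODEL; O.2 item (v) «k-UNIFORM constants», entry level)

For `A = levelOp` on the torus as in `MultiscaleDecay` (level weights on a pairwise-disjoint COVERING cube family, print-size from
above, ANY isometric `Rm`, `T`, ANY cell-sum coercivity `C`) and ANY domain `Ω₀ = {χ = 1}` (`χ` a characteristic function on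
sites × components), pv21's Dirichlet inverse `G′ = dirInv A χ = Ω₀(Ω₀AΩ₀ + (1 − Ω₀))⁻¹Ω₀` obeys
**`|G′(δ_{(y,i′)})(x,i)| ≤ e^{−κ·d_n(x,y)}·n(x)·n(y)/min(μ₀, 1)`**, `μ₀ = C − 2d·c_max²κ² − a_max(e^{2dκ} − 1) > 0`, `0 ≤ κ ≤ 1` —
the SAME rate per cell-size unit and the SAME local prefactors as the full inverse, for EVERY `Ω₀`, uniformly in `Ω₀`: the
MODEL image of the uniformity of [B9]'s local propagators `G′_□` (p. 409) in the box (the sandwich costs nothing: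
`CovariantTowerDecayCT.conjErr_sandwich`, and the whole-torus hypothesis `MultiscaleDecay.hc_levelOp` applied to `Ω₀v`)
(unit `b2b-balaban-beta-d4-p2`, GEN 8, MODEL crew; claim «MULTISCALE-DECAY-MODEL» journal l.18614∕l.19202, node (w3) first half).

HONEST FRAMING: discharging `BetaPertH` makes Bałaban's UV stability UNCONDITIONAL — NOT the continuum limit, NOT the Clay problem.
HONEST DEPENDENCY (verbatim): «continuum YM on T⁴ ⇐ BetaPertH ∧ nine spine estimates (0/9 proved); BetaPertH ⇐ (D1) ∧ (D4) ∧ CAP+tail;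
G-an2-4 gates asym, D1 and NE2/3/4.»  THIS MODULE DISCHARGES NOTHING of `BetaPertH`, asserts NOTHING printed and cites nothing as a fact
(ABSOLUTE RULE): [folklore] Combes–Thomas bookkeeping about the pv21∕b05 torus MODEL (`levelOp`, `dirInv`, cube cells); all weights,
coefficients, transports and the domain `χ` are DATA.  CURRENCY: ENTRY level (d4-p3 C-d4p3-28 INFO-1); print's sup-norm (3.42) needs the
ℓ² → ℓ^∞ device in addition — NOT claimed.  NOT here: the scale-ADAPTED parametrix (3.88) with these local inverses (node (w4)), print's
hulls `Ω₀(□)` between `□̃⁴` and `□̃⁵`, region geometry, Bałaban's own `U_k`, `Ū^l`, vector operators.  LOCI (shape only): [B9] =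
`Balaban1985BackgroundPropagators` p. 394 (`Ω₀Δ′_aΩ₀`, `G′`), (3.24) p. 394, Thm 3.1 (3.42) p. 397, (3.86)–(3.88) pp. 408–409 (`G′_□`);
[B6] = `Balaban1984PropagatorsII` (2.43)–(2.44) p. 230, (2.46) p. 231.  No class change on row D4 (critical-path width 0; D4 DISCHARGE NO
DATE); NOT BetaPertH, NOT continuum, NOT Clay, NOT summit progress.

CONTENT (kernel, 0 sorry).  §1 `qform_sandwich` (⟨v, (Ω₀AΩ₀ + (1 − Ω₀))v⟩ = ⟨Ω₀v, AΩ₀v⟩ + Σ(1 − χ)v²), **`hc_sandwich`** (the owner's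
hypothesis for the sandwich with profile `min(μ₀,1)·n(p)⁻²`, from `hc_levelOp` at `Ω₀v` + `conjErr_sandwich`), `dirInv_apply_single`
(`G′(δ_q)(p) = χ(p)χ(q)·(sandwich)⁻¹(δ_q)(p)`).  §2 **`decay_dirInv_levelOp`** (THE END, every `χ`), corollaries **`decay_dirInv_flat`**
((D)) and **`decay_dirInv_cov`** ((H)).
-/

namespace Summit.QuantumFields.BalabanUV.Beta.MultiscaleDecayDirichlet

open Finset Function
open Summit.QuantumFields.BalabanUV.Beta.BoxPoincare (Box)
open Summit.QuantumFields.BalabanUV.Beta.CovariantBoxPoincare (hol succ)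
open Summit.QuantumFields.BalabanUV.Beta.MultiscaleCoerciveTorus
open Summit.QuantumFields.BalabanUV.Beta.MultiscaleCoerciveTorusCov (multiscale_coercive_torus_cov)
open Summit.QuantumFields.BalabanUV.Beta.MultiscaleConjError (siteSq siteSq_nonneg conjForm_eq)
open Summit.QuantumFields.BalabanUV.Beta.MultiscaleDistance
open Summit.QuantumFields.BalabanUV.Beta.MultiscaleDecayBudget
open Summit.QuantumFields.BalabanUV.Beta.MultiscaleDecay
open Summit.QuantumFields.BalabanUV.Beta.MultiscaleCombesThomasBudget (norm_cmat_inv_apply_le_local)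
open Summit.QuantumFields.BalabanUV.Beta.CovariantTowerMatrix (cmat cmat_ringInverse norm_cmat_apply)
open Summit.QuantumFields.BalabanUV.Beta.CovariantTowerDecayCT (conjErr_sandwich)
open Literature.MathematicalPhysics.QuantumFieldTheory.Balaban1983to89
open Literature.MathematicalPhysics.QuantumFieldTheory.Balaban1983to89.B9Thm37Sum (mulOp mulOp_apply)
open Literature.MathematicalPhysics.QuantumFieldTheory.Balaban1983to89.B9Thm37GluePU (bsrc btgt bsrc_apply btgt_apply)
open Literature.MathematicalPhysics.QuantumFieldTheory.Balaban1983to89.B9Thm37GlueTorusCov (tblk torusComb)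
open Literature.MathematicalPhysics.QuantumFieldTheory.Balaban1983to89.B9Thm37GlueTorusCovLevels (levelOp)
open Literature.MathematicalPhysics.QuantumFieldTheory.Balaban1983to89.B9Thm37GlueTorusCovCT (expW conjErr)
open Literature.MathematicalPhysics.QuantumFieldTheory.Balaban1983to89.B9Thm37GlueTorusInv (isUnit_of_posDef posDef_sandwich
  compl_add dirInv)
open B5TorusCover (UT Ctr ctrU)

noncomputable section

variable {d : ℕ} {N : Fin d → ℕ} [∀ i, NeZero (N i)] [NeZero d] {Cp J K : Type} [Fintype Cp] [DecidableEq Cp] [Fintype J] [Fintype K]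
  (S : J → ℕ) (hS : ∀ l, 1 ≤ S l) (hdivS : ∀ l i, S l ∣ N i) (lvl : K → J) (zc : (k : K) → Ctr N (S (lvl k)))

/-! ## §1 The sandwich: quadratic form, the owner's hypothesis, entries of the Dirichlet inverse -/

section Sandwich

variable {X : Type} [Fintype X] [DecidableEq X]

omit [∀ i, NeZero (N i)] [NeZero d] [Fintype Cp] [DecidableEq Cp] [Fintype J] [Fintype K] [DecidableEq X] in
/-- **The quadratic form of a Dirichlet sandwich**: `⟨v, (Ω₀AΩ₀ + (1 − Ω₀))v⟩ = ⟨Ω₀v, A(Ω₀v)⟩ + Σ_p (1 − χ_p)·v_p²`. [folklore] -/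
theorem qform_sandwich (A : Module.End ℝ (X → ℝ)) (χ : X → ℝ) (v : X → ℝ) :
    ∑ p, v p * (mulOp χ * A * mulOp χ + mulOp (1 - χ) : Module.End ℝ (X → ℝ)) v p =
      ∑ p, (fun p => χ p * v p) p * A (fun p => χ p * v p) p + ∑ p, (1 - χ p) * v p ^ 2 := by
  have eχ : mulOp χ v = fun p => χ p * v p := funext fun p => mulOp_apply χ v p
  rw [← Finset.sum_add_distrib]
  refine Finset.sum_congr rfl fun p _ => ?_
  simp only [LinearMap.add_apply, Pi.add_apply, Module.End.mul_apply, eχ, mulOp_apply, Pi.sub_apply, Pi.one_apply]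
  ring

omit [∀ i, NeZero (N i)] [NeZero d] [Fintype Cp] [DecidableEq Cp] [Fintype J] [Fintype K] [Fintype X] in
/-- **Entries of the Dirichlet inverse**: `G′(δ_q)(p) = χ(p)·χ(q)·(Ω₀AΩ₀ + (1 − Ω₀))⁻¹(δ_q)(p)`. [folklore] -/
theorem dirInv_apply_single (A : Module.End ℝ (X → ℝ)) (χ : X → ℝ) (p q : X) :
    dirInv A χ (Pi.single q 1) p =
      χ p * χ q * Ring.inverse (mulOp χ * A * mulOp χ + mulOp (1 - χ) : Module.End ℝ (X → ℝ)) (Pi.single q 1) p := by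
  have e : mulOp χ (Pi.single q (1 : ℝ) : X → ℝ) = χ q • (Pi.single q (1 : ℝ) : X → ℝ) := by
    funext x
    rw [mulOp_apply, Pi.smul_apply, smul_eq_mul]
    by_cases hx : x = q
    · subst hx; rfl
    · rw [Pi.single_eq_of_ne hx, mul_zero, mul_zero]
  rw [dirInv, Module.End.mul_apply, Module.End.mul_apply, e, map_smul, mulOp_apply, Pi.smul_apply, smul_eq_mul]
  ring

end Sandwich

section Hyp

/-- **THE SITEWISE CONJUGATED COERCIVITY OF THE DIRICHLET SANDWICH (MODEL).**  Under the hypotheses of `MultiscaleDecay.hc_levelOp`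
and for ANY {0,1}-valued `χ` on sites × components, the sandwich `Ω₀AΩ₀ + (1 − Ω₀)` of `A = levelOp` satisfies the owner's hypothesis
`hc` along the weight `κ·d_n(·, y₁)` with the profile `min(μ₀, 1)·n(p₁)⁻²` — the sandwich commutes with the conjugation
(`conjErr_sandwich`), `hc_levelOp` is applied to `Ω₀v`, and the identity block contributes `Σ(1 − χ)v² ≥ Σ_{χ=0} n⁻²v²`.
[cite: Balaban1985BackgroundPropagators, p.394 + Thm 3.1 (3.42) p.397 + (3.86)–(3.88) pp.408–409] -/
theorem hc_sandwich (hdisj : ∀ k k' v v', cellPt S hS hdivS lvl zc k v = cellPt S hS hdivS lvl zc k' v' → k = k')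
    (hcover : ∀ x : UT N, ∃ k, ∃ v : Box d (S (lvl k)), cellPt S hS hdivS lvl zc k v = x)
    (Rm : UT N × Fin d → Cp → Cp → ℝ) (hRm : ∀ b i j, ∑ k, Rm b k i * Rm b k j = if i = j then (1 : ℝ) else 0)
    (T : J → UT N → Cp → Cp → ℝ) (hT : ∀ l x i i', ∑ k, T l x k i * T l x k i' = if i = i' then (1 : ℝ) else 0)
    (a : J → ℝ) (ha : ∀ j, 0 ≤ a j) (ω : J → UT N → ℝ)
    (hsupp : ∀ l x, ω l (ctrU N (S l) (tblk (hS l) (hdivS l) x)) ≠ 0 → ∃ k v, lvl k = l ∧ cellPt S hS hdivS lvl zc k v = x)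
    {amax : ℝ} (hamax : 0 ≤ amax)
    (hscale : ∀ k, a (lvl k) * ω (lvl k) (ctrU N (S (lvl k)) (zc k)) ^ 2 * (S (lvl k) : ℝ) ^ d ≤ amax / (S (lvl k) : ℝ) ^ 2)
    (c : UT N × Fin d → ℝ) {cmax : ℝ} (hc : ∀ b, |c b| ≤ cmax) {C : ℝ}
    (hcoer : ∀ f : UT N × Cp → ℝ,
      C * ∑ k, ((S (lvl k) : ℝ) ^ 2)⁻¹ * ∑ v : Box d (S (lvl k)), ∑ i, f (cellPt S hS hdivS lvl zc k v, i) ^ 2 ≤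
        ∑ p, f p * levelOp bsrc btgt c Rm (fun l x => ctrU N (S l) (tblk (hS l) (hdivS l) x))
          (fun l x => ω l (ctrU N (S l) (tblk (hS l) (hdivS l) x))) T a f p)
    {κ : ℝ} (hκ0 : 0 ≤ κ) (hκ1 : κ ≤ 1)
    (χ : UT N × Cp → ℝ) (hχ : ∀ p, χ p = 0 ∨ χ p = 1) (y : UT N × Cp) (v : UT N × Cp → ℝ) :
    ∑ p, min (C - 2 * d * cmax ^ 2 * κ ^ 2 - amax * (Real.exp (2 * d * κ) - 1)) 1 *
        ((siteScale S hS hdivS lvl zc hcover p.1 : ℝ) ^ 2)⁻¹ * v p ^ 2 ≤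
      ∑ p, Real.exp (κ * sdist bsrc btgt (siteScale S hS hdivS lvl zc hcover) p.1 y.1) * v p *
        (mulOp χ * levelOp bsrc btgt c Rm (fun l x => ctrU N (S l) (tblk (hS l) (hdivS l) x))
            (fun l x => ω l (ctrU N (S l) (tblk (hS l) (hdivS l) x))) T a * mulOp χ + mulOp (1 - χ) :
          Module.End ℝ (UT N × Cp → ℝ))
          (fun q => Real.exp (-(κ * sdist bsrc btgt (siteScale S hS hdivS lvl zc hcover) q.1 y.1)) * v q) p := by
  -- `hc_levelOp` at the truncated vector `Ω₀v` (taken first, so that the abbreviations below rewrite it too)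
  have hlev := hc_levelOp S hS hdivS lvl zc hdisj hcover Rm hRm T hT a ha ω hsupp hamax hscale c hc hcoer hκ0 hκ1 y
    (fun p => χ p * v p)
  set n := siteScale S hS hdivS lvl zc hcover with hn
  set A := levelOp bsrc btgt c Rm (fun l x => ctrU N (S l) (tblk (hS l) (hdivS l) x))
    (fun l x => ω l (ctrU N (S l) (tblk (hS l) (hdivS l) x))) T a with hA
  set μ₀ := C - 2 * d * cmax ^ 2 * κ ^ 2 - amax * (Real.exp (2 * d * κ) - 1) with hμ₀
  set φ : UT N → ℝ := fun x => κ * sdist bsrc btgt n x y.1 with hφ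
  set Sw := (mulOp χ * A * mulOp χ + mulOp (1 - χ) : Module.End ℝ (UT N × Cp → ℝ)) with hSw
  -- the conjugated pairing of the sandwich
  have hpair : ∑ p, Real.exp (κ * sdist bsrc btgt n p.1 y.1) * v p *
      Sw (fun q => Real.exp (-(κ * sdist bsrc btgt n q.1 y.1)) * v q) p = ∑ p, v p * Sw v p + conjErr Sw φ v := by
    rw [← conjForm_eq Sw φ v]
    rfl
  rw [hpair, hSw, conjErr_sandwich A χ φ v, qform_sandwich A χ v]
  set w : UT N × Cp → ℝ := fun p => χ p * v p with hw
  have hpairA : ∑ p, Real.exp (κ * sdist bsrc btgt n p.1 y.1) * w p *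
      A (fun q => Real.exp (-(κ * sdist bsrc btgt n q.1 y.1)) * w q) p = ∑ p, w p * A w p + conjErr A φ w := by
    rw [← conjForm_eq A φ w]
    rfl
  have hlev' : ∑ p, μ₀ * ((n p.1 : ℝ) ^ 2)⁻¹ * w p ^ 2 ≤ ∑ p, w p * A w p + conjErr A φ w := by
    rw [← hpairA]
    exact hlev
  -- sitewise comparison of the profiles
  have hpt : ∀ p : UT N × Cp, min μ₀ 1 * ((n p.1 : ℝ) ^ 2)⁻¹ * v p ^ 2 ≤
      μ₀ * ((n p.1 : ℝ) ^ 2)⁻¹ * w p ^ 2 + (1 - χ p) * v p ^ 2 := by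
    intro p
    have hinv0 : 0 ≤ ((n p.1 : ℝ) ^ 2)⁻¹ := inv_nonneg.mpr (sq_nonneg _)
    have hinv1 : ((n p.1 : ℝ) ^ 2)⁻¹ ≤ 1 := by
      have h1 : (1 : ℝ) ≤ n p.1 := by exact_mod_cast one_le_siteScale S hS hdivS lvl zc hcover p.1
      exact inv_le_one_of_one_le₀ (one_le_pow₀ h1)
    rcases hχ p with h0 | h1
    · rw [hw]
      simp only
      rw [h0, zero_mul, sub_zero, one_mul, zero_pow two_ne_zero, mul_zero, zero_add]
      calc min μ₀ 1 * ((n p.1 : ℝ) ^ 2)⁻¹ * v p ^ 2 ≤ 1 * 1 * v p ^ 2 :=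
            mul_le_mul_of_nonneg_right (mul_le_mul (min_le_right _ _) hinv1 hinv0 zero_le_one) (sq_nonneg _)
        _ = v p ^ 2 := by ring
    · rw [hw]
      simp only
      rw [h1, one_mul, sub_self, zero_mul, add_zero]
      exact mul_le_mul_of_nonneg_right (mul_le_mul_of_nonneg_right (min_le_left _ _) hinv0) (sq_nonneg _)
  calc ∑ p, min μ₀ 1 * ((n p.1 : ℝ) ^ 2)⁻¹ * v p ^ 2
      ≤ ∑ p, (μ₀ * ((n p.1 : ℝ) ^ 2)⁻¹ * w p ^ 2 + (1 - χ p) * v p ^ 2) := Finset.sum_le_sum fun p _ => hpt p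
    _ = ∑ p, μ₀ * ((n p.1 : ℝ) ^ 2)⁻¹ * w p ^ 2 + ∑ p, (1 - χ p) * v p ^ 2 := Finset.sum_add_distrib
    _ ≤ (∑ p, w p * A w p + conjErr A φ w) + ∑ p, (1 - χ p) * v p ^ 2 := by linarith [hlev']
    _ = _ := by ring

end Hyp

/-! ## §2 THE END: Dirichlet inverses on every domain decay with the same local prefactors -/

section End

/-- **THE DIRICHLET INVERSES OF THE MULTI-REGION AVERAGED OPERATOR DECAY k-UNIFORMLY WITH LOCAL PREFACTORS, ON EVERY DOMAIN (MODEL;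
node (w3), first half).**  Under the hypotheses of `MultiscaleDecay.decay_levelOp` and for ANY {0,1}-valued `χ` (domain `Ω₀ = {χ = 1}`):
the sandwich `Ω₀AΩ₀ + (1 − Ω₀)` is a unit and pv21's `G′ = dirInv A χ` satisfies
**`|G′(δ_{(y,i′)})(x,i)| ≤ e^{−κ·d_n(x,y)}·n(x)·n(y)/min(μ₀, 1)`** — the same rate per cell-size unit and the same local prefactors as the
full inverse, uniformly in the domain (the SHAPE of the uniformity of the local propagators `G′_□` of (3.86)–(3.88) in `□`).
[cite: Balaban1985BackgroundPropagators, p.394 + Thm 3.1 (3.42) p.397 + (3.86)–(3.88) pp.408–409; Balaban1984PropagatorsII, (2.43)–(2.44) p.230] -/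
theorem decay_dirInv_levelOp (hdisj : ∀ k k' v v', cellPt S hS hdivS lvl zc k v = cellPt S hS hdivS lvl zc k' v' → k = k')
    (hcover : ∀ x : UT N, ∃ k, ∃ v : Box d (S (lvl k)), cellPt S hS hdivS lvl zc k v = x)
    (Rm : UT N × Fin d → Cp → Cp → ℝ) (hRm : ∀ b i j, ∑ k, Rm b k i * Rm b k j = if i = j then (1 : ℝ) else 0)
    (T : J → UT N → Cp → Cp → ℝ) (hT : ∀ l x i i', ∑ k, T l x k i * T l x k i' = if i = i' then (1 : ℝ) else 0)
    (a : J → ℝ) (ha : ∀ j, 0 ≤ a j) (ω : J → UT N → ℝ)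
    (hsupp : ∀ l x, ω l (ctrU N (S l) (tblk (hS l) (hdivS l) x)) ≠ 0 → ∃ k v, lvl k = l ∧ cellPt S hS hdivS lvl zc k v = x)
    {amax : ℝ} (hamax : 0 ≤ amax)
    (hscale : ∀ k, a (lvl k) * ω (lvl k) (ctrU N (S (lvl k)) (zc k)) ^ 2 * (S (lvl k) : ℝ) ^ d ≤ amax / (S (lvl k) : ℝ) ^ 2)
    (c : UT N × Fin d → ℝ) {cmax : ℝ} (hc : ∀ b, |c b| ≤ cmax) {C : ℝ}
    (hcoer : ∀ f : UT N × Cp → ℝ,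
      C * ∑ k, ((S (lvl k) : ℝ) ^ 2)⁻¹ * ∑ v : Box d (S (lvl k)), ∑ i, f (cellPt S hS hdivS lvl zc k v, i) ^ 2 ≤
        ∑ p, f p * levelOp bsrc btgt c Rm (fun l x => ctrU N (S l) (tblk (hS l) (hdivS l) x))
          (fun l x => ω l (ctrU N (S l) (tblk (hS l) (hdivS l) x))) T a f p)
    {κ : ℝ} (hκ0 : 0 ≤ κ) (hκ1 : κ ≤ 1) (hμ : 0 < C - 2 * d * cmax ^ 2 * κ ^ 2 - amax * (Real.exp (2 * d * κ) - 1))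
    (χ : UT N × Cp → ℝ) (hχ : ∀ p, χ p = 0 ∨ χ p = 1) (p q : UT N × Cp) :
    IsUnit (mulOp χ * levelOp bsrc btgt c Rm (fun l x => ctrU N (S l) (tblk (hS l) (hdivS l) x))
          (fun l x => ω l (ctrU N (S l) (tblk (hS l) (hdivS l) x))) T a * mulOp χ + mulOp (1 - χ) :
        Module.End ℝ (UT N × Cp → ℝ)) ∧
      |dirInv (levelOp bsrc btgt c Rm (fun l x => ctrU N (S l) (tblk (hS l) (hdivS l) x))
          (fun l x => ω l (ctrU N (S l) (tblk (hS l) (hdivS l) x))) T a) χ (Pi.single q 1) p| ≤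
        Real.exp (-(κ * sdist bsrc btgt (siteScale S hS hdivS lvl zc hcover) p.1 q.1)) *
          ((siteScale S hS hdivS lvl zc hcover p.1 : ℝ) * (siteScale S hS hdivS lvl zc hcover q.1 : ℝ)) /
          min (C - 2 * d * cmax ^ 2 * κ ^ 2 - amax * (Real.exp (2 * d * κ) - 1)) 1 := by
  classical
  set n := siteScale S hS hdivS lvl zc hcover with hn
  set A := levelOp bsrc btgt c Rm (fun l x => ctrU N (S l) (tblk (hS l) (hdivS l) x))
    (fun l x => ω l (ctrU N (S l) (tblk (hS l) (hdivS l) x))) T a with hA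
  set μ₀ := C - 2 * d * cmax ^ 2 * κ ^ 2 - amax * (Real.exp (2 * d * κ) - 1) with hμ₀
  set Sw := (mulOp χ * A * mulOp χ + mulOp (1 - χ) : Module.End ℝ (UT N × Cp → ℝ)) with hSw
  have hn0 : ∀ x, (0 : ℝ) < n x := fun x => by exact_mod_cast one_le_siteScale S hS hdivS lvl zc hcover x
  have hm : 0 < min μ₀ 1 := lt_min hμ zero_lt_one
  -- A is strictly positive; so is the sandwich
  have hC : 0 < C := by
    have h1 : 0 ≤ 2 * (d : ℝ) * cmax ^ 2 * κ ^ 2 := by positivity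
    have h2 : 0 ≤ amax * (Real.exp (2 * d * κ) - 1) := by
      refine mul_nonneg hamax ?_
      have : 0 ≤ 2 * (d : ℝ) * κ := by positivity
      linarith [Real.one_le_exp_iff.mpr this]
    linarith
  have hApos : ∀ f : UT N × Cp → ℝ, f ≠ 0 → 0 < ∑ x, f x * A f x := by
    intro f hf
    have h : C * ∑ x, ((n x : ℝ) ^ 2)⁻¹ * siteSq f x ≤ ∑ p, f p * A f p := by
      rw [hn, ← sum_cells_scale_eq S hS hdivS lvl zc hdisj hcover (siteSq f)]
      exact hcoer f
    refine lt_of_lt_of_le ?_ h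
    obtain ⟨⟨x₀, i₀⟩, hx₀⟩ := Function.ne_iff.mp hf
    refine mul_pos hC (lt_of_lt_of_le ?_ (Finset.single_le_sum (f := fun x => ((n x : ℝ) ^ 2)⁻¹ * siteSq f x)
      (fun x _ => mul_nonneg (inv_nonneg.mpr (sq_nonneg _)) (siteSq_nonneg f x)) (mem_univ x₀)))
    refine mul_pos (inv_pos.mpr (pow_pos (hn0 x₀) 2)) ?_
    exact lt_of_lt_of_le (lt_of_le_of_ne (sq_nonneg (f (x₀, i₀))) (Ne.symm (pow_ne_zero 2 hx₀)))
      (Finset.single_le_sum (f := fun i => f (x₀, i) ^ 2) (fun i _ => sq_nonneg _) (mem_univ i₀))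
  have hSpos : ∀ f : UT N × Cp → ℝ, f ≠ 0 → 0 < ∑ x, f x * Sw f x := posDef_sandwich hApos hχ (compl_add χ)
  have hunit : IsUnit Sw := isUnit_of_posDef hSpos
  refine ⟨hunit, ?_⟩
  -- the owner's END for the sandwich
  set μ : UT N × Cp → ℝ := fun p => min μ₀ 1 * ((n p.1 : ℝ) ^ 2)⁻¹ with hμdef
  have hμpos : ∀ e, 0 < μ e := fun e => mul_pos hm (inv_pos.mpr (pow_pos (hn0 e.1) 2))
  set dd : UT N × Cp → UT N × Cp → ℝ := fun p q => sdist bsrc btgt n p.1 q.1 with hdd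
  have hd0 : ∀ j, dd j j = 0 := fun j => sdist_self bsrc btgt n j.1
  have hcH : ∀ j, ∀ w : UT N × Cp → ℝ, ∑ e, μ e * w e ^ 2 ≤
      ∑ e, Real.exp (κ * dd e j) * w e * Sw (fun q => Real.exp (-(κ * dd q j)) * w q) e := by
    intro j w
    have h := hc_sandwich S hS hdivS lvl zc hdisj hcover Rm hRm T hT a ha ω hsupp hamax hscale c hc hcoer hκ0 hκ1 χ hχ j w
    refine le_trans (le_of_eq (Finset.sum_congr rfl fun e _ => ?_)) h
    rw [hμdef]
  have hEND := norm_cmat_inv_apply_le_local Sw dd hd0 hκ0 hμpos hcH p q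
  have hcm : ((LinearMap.toMatrix' Sw).map Complex.ofRealHom) = cmat Sw := rfl
  rw [hcm, ← cmat_ringInverse hunit, norm_cmat_apply] at hEND
  have hsqrt : Real.sqrt (μ p * μ q) = min μ₀ 1 / ((n p.1 : ℝ) * (n q.1 : ℝ)) := by
    have hp := hn0 p.1
    have hq := hn0 q.1
    have e : μ p * μ q = (min μ₀ 1 / ((n p.1 : ℝ) * (n q.1 : ℝ))) ^ 2 := by
      rw [hμdef]
      field_simp
    rw [e, Real.sqrt_sq (div_nonneg hm.le (mul_nonneg hp.le hq.le))]
  rw [hsqrt, div_div_eq_mul_div] at hEND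
  -- the Dirichlet inverse's entries are the sandwich's, cut by χ(p)χ(q) ∈ [0, 1]
  rw [dirInv_apply_single]
  have hχabs : ∀ r, |χ r| ≤ 1 := fun r => by rcases hχ r with h | h <;> simp [h]
  calc |χ p * χ q * Ring.inverse Sw (Pi.single q 1) p|
      = |χ p| * |χ q| * |Ring.inverse Sw (Pi.single q 1) p| := by rw [abs_mul, abs_mul]
    _ ≤ 1 * 1 * |Ring.inverse Sw (Pi.single q 1) p| :=
        mul_le_mul_of_nonneg_right (mul_le_mul (hχabs p) (hχabs q) (abs_nonneg _) zero_le_one) (abs_nonneg _)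
    _ = |Ring.inverse Sw (Pi.single q 1) p| := by ring
    _ ≤ _ := hEND

/-- **Dirichlet decay at `U = 1` (MODEL)** — (D)'s operator, every domain `χ`, `C = min(c_min²/(4d), a_min/2)`.
[cite: Balaban1985BackgroundPropagators, p.394 + (3.24) p.394 + Thm 3.1 (3.42) p.397] -/
theorem decay_dirInv_flat (hdisj : ∀ k k' v v', cellPt S hS hdivS lvl zc k v = cellPt S hS hdivS lvl zc k' v' → k = k')
    (hcover : ∀ x : UT N, ∃ k, ∃ v : Box d (S (lvl k)), cellPt S hS hdivS lvl zc k v = x)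
    (a : J → ℝ) (ha : ∀ j, 0 ≤ a j) (ω : J → UT N → ℝ)
    (hsupp : ∀ l x, ω l (ctrU N (S l) (tblk (hS l) (hdivS l) x)) ≠ 0 → ∃ k v, lvl k = l ∧ cellPt S hS hdivS lvl zc k v = x)
    {amin amax : ℝ} (hamin : 0 ≤ amin) (hamax : 0 ≤ amax)
    (hscale_lo : ∀ k, amin / (S (lvl k) : ℝ) ^ 2 ≤ a (lvl k) * ω (lvl k) (ctrU N (S (lvl k)) (zc k)) ^ 2 * (S (lvl k) : ℝ) ^ d)
    (hscale_hi : ∀ k, a (lvl k) * ω (lvl k) (ctrU N (S (lvl k)) (zc k)) ^ 2 * (S (lvl k) : ℝ) ^ d ≤ amax / (S (lvl k) : ℝ) ^ 2)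
    (c : UT N × Fin d → ℝ) {cmin cmax : ℝ} (hcmin : 0 < cmin) (hc_lo : ∀ b, cmin ≤ |c b|) (hc_hi : ∀ b, |c b| ≤ cmax)
    {κ : ℝ} (hκ0 : 0 ≤ κ) (hκ1 : κ ≤ 1)
    (hμ : 0 < min (cmin ^ 2 / (4 * d)) (amin / 2) - 2 * d * cmax ^ 2 * κ ^ 2 - amax * (Real.exp (2 * d * κ) - 1))
    (χ : UT N × Cp → ℝ) (hχ : ∀ p, χ p = 0 ∨ χ p = 1) (p q : UT N × Cp) :
    |dirInv (levelOp bsrc btgt c (fun _ => (oneM : Cp → Cp → ℝ)) (fun l x => ctrU N (S l) (tblk (hS l) (hdivS l) x))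
          (fun l x => ω l (ctrU N (S l) (tblk (hS l) (hdivS l) x))) (fun _ _ => (oneM : Cp → Cp → ℝ)) a) χ (Pi.single q 1) p| ≤
      Real.exp (-(κ * sdist bsrc btgt (siteScale S hS hdivS lvl zc hcover) p.1 q.1)) *
        ((siteScale S hS hdivS lvl zc hcover p.1 : ℝ) * (siteScale S hS hdivS lvl zc hcover q.1 : ℝ)) /
        min (min (cmin ^ 2 / (4 * d)) (amin / 2) - 2 * d * cmax ^ 2 * κ ^ 2 - amax * (Real.exp (2 * d * κ) - 1)) 1 :=
  (decay_dirInv_levelOp S hS hdivS lvl zc hdisj hcover (fun _ => oneM) (fun _ i j => oneM_orth i j) (fun _ _ => oneM)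
    (fun _ _ i i' => oneM_orth i i') a ha ω hsupp hamax hscale_hi c hc_hi
    (fun f => multiscale_coercive_torus_flat (Nat.one_le_iff_ne_zero.mpr (NeZero.ne d)) S hS hdivS a ha ω c hcmin hc_lo lvl zc
      hdisj hamin hscale_lo f)
    hκ0 hκ1 hμ χ hχ p q).2

/-- **COVARIANT Dirichlet decay under a per-cube (3.35)-shape gauge (MODEL)** — (H)'s operator, every domain `χ`,
`C = (1 − θ)·min(c_min²/(4d), a_min/4)`.
[cite: Balaban1985BackgroundPropagators, p.394 + (3.19) p.393 + (3.24) p.394 + (3.35) p.396 + Thm 3.1 (3.42) p.397] -/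
theorem decay_dirInv_cov (hdisj : ∀ k k' v v', cellPt S hS hdivS lvl zc k v = cellPt S hS hdivS lvl zc k' v' → k = k')
    (hcover : ∀ x : UT N, ∃ k, ∃ v : Box d (S (lvl k)), cellPt S hS hdivS lvl zc k v = x)
    (Rm : UT N × Fin d → Cp → Cp → ℝ) (hRm : ∀ b i j, ∑ k, Rm b k i * Rm b k j = if i = j then (1 : ℝ) else 0)
    (a : J → ℝ) (ha : ∀ j, 0 ≤ a j) (ω : J → UT N → ℝ)
    (hsupp : ∀ l x, ω l (ctrU N (S l) (tblk (hS l) (hdivS l) x)) ≠ 0 → ∃ k v, lvl k = l ∧ cellPt S hS hdivS lvl zc k v = x)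
    {amin amax : ℝ} (hamin : 0 ≤ amin) (hamax : 0 ≤ amax)
    (hscale_lo : ∀ k, amin / (S (lvl k) : ℝ) ^ 2 ≤ a (lvl k) * ω (lvl k) (ctrU N (S (lvl k)) (zc k)) ^ 2 * (S (lvl k) : ℝ) ^ d)
    (hscale_hi : ∀ k, a (lvl k) * ω (lvl k) (ctrU N (S (lvl k)) (zc k)) ^ 2 * (S (lvl k) : ℝ) ^ d ≤ amax / (S (lvl k) : ℝ) ^ 2)
    (c : UT N × Fin d → ℝ) {cmin cmax : ℝ} (hcmin : 0 < cmin) (hc_lo : ∀ b, cmin ≤ |c b|) (hc_hi : ∀ b, |c b| ≤ cmax)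
    (g : (k : K) → Box d (S (lvl k)) → Cp → Cp → ℝ)
    (hg : ∀ k v i i', ∑ k', g k v k' i * g k v k' i' = if i = i' then (1 : ℝ) else 0) (ε : K → ℝ) (hε : ∀ k, 0 ≤ ε k)
    (hgauge : ∀ k (v : Box d (S (lvl k))) (i : Fin d) (hv : (v i : ℕ) + 1 < S (lvl k)) (u : Cp → ℝ),
      ∑ a', (∑ j, (hol Rm (g k) (fun v i _ => (cellPt S hS hdivS lvl zc k v, i)) v i hv a' j -
        if a' = j then 1 else 0) * u j) ^ 2 ≤ ε k ^ 2 * ∑ j, u j ^ 2)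
    {θ : ℝ} (hloss : ∀ k, 4 * ((d : ℝ) * (S (lvl k)) * ((S (lvl k) : ℝ) - 1)) * d * ε k ^ 2 +
      4 * ((d * (S (lvl k) - 1) : ℕ) * ε k) ^ 2 ≤ θ)
    {κ : ℝ} (hκ0 : 0 ≤ κ) (hκ1 : κ ≤ 1)
    (hμ : 0 < (1 - θ) * min (cmin ^ 2 / (4 * d)) (amin / 4) - 2 * d * cmax ^ 2 * κ ^ 2 - amax * (Real.exp (2 * d * κ) - 1))
    (χ : UT N × Cp → ℝ) (hχ : ∀ p, χ p = 0 ∨ χ p = 1) (p q : UT N × Cp) :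
    |dirInv (levelOp bsrc btgt c Rm (fun l x => ctrU N (S l) (tblk (hS l) (hdivS l) x))
          (fun l x => ω l (ctrU N (S l) (tblk (hS l) (hdivS l) x))) (fun l x => (torusComb (hS l) (hdivS l)).tr Rm x) a) χ
        (Pi.single q 1) p| ≤
      Real.exp (-(κ * sdist bsrc btgt (siteScale S hS hdivS lvl zc hcover) p.1 q.1)) *
        ((siteScale S hS hdivS lvl zc hcover p.1 : ℝ) * (siteScale S hS hdivS lvl zc hcover q.1 : ℝ)) /
        min ((1 - θ) * min (cmin ^ 2 / (4 * d)) (amin / 4) - 2 * d * cmax ^ 2 * κ ^ 2 - amax * (Real.exp (2 * d * κ) - 1)) 1 :=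
  (decay_dirInv_levelOp S hS hdivS lvl zc hdisj hcover Rm hRm (fun l x => (torusComb (hS l) (hdivS l)).tr Rm x)
    (fun l x i i' => (torusComb (hS l) (hdivS l)).tr_orth Rm hRm x i i') a ha ω hsupp hamax hscale_hi c hc_hi
    (fun f => multiscale_coercive_torus_cov (Nat.one_le_iff_ne_zero.mpr (NeZero.ne d)) S hS hdivS Rm hRm a ha ω c hcmin hc_lo lvl zc
      hdisj hamin hscale_lo g hg ε hε hgauge hloss f)
    hκ0 hκ1 hμ χ hχ p q).2

end End

end

end Summit.QuantumFields.BalabanUV.Beta.MultiscaleDecayDirichlet
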